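import Mathlib.MeasureTheory.Function.LpSeminorm.CompareExp
import Mathlib.MeasureTheory.Function.LpSeminorm.TriangleInequality
import Mathlib.MeasureTheory.Measure.OpenPos
import Literature.Analysis.FluidPDE.TorusForceBookkeeping
import HarnessLib

/-!
# Mixed norms `L^q_t L^p_x` of jointly smooth space–time fields on the flat torus

Analysis/FluidPDE support file (all proved, [folklore]): the elementary bookkeeping that lets one
manipulate the accepted mixed norms `Torus.eLqLpNorm q p w (Ioo 0 T)` (`Literature.Analysis.FluidPDE.LerayHopf`,
Serrin 1963 §3) of fields `w` that are jointly smooth on `[0, T] × 𝕋^d`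
(`Torus.IsSmoothSpaceTimeOn (Icc 0 T) w`) without meeting the junk value of the inner
`ENNReal.toReal`:

* slice norms are finite and **continuous in time** (`IsSmoothSpaceTimeOn.eLpNorm_slice_lt_top`,
  `IsSmoothSpaceTimeOn.continuousOn_eLpNorm_toReal`, tube lemma over the compact torus), hence
  a.e. strongly measurable on `(0, T)` (`IsSmoothSpaceTimeOn.aestronglyMeasurable_eLpNorm_toReal`);
* a uniform pointwise bound `‖w‖ ≤ C` gives `‖w‖_{L^q(0,T;L^p)} ≤ max(1,T) C`
  (`Torus.eLqLpNorm_le_of_forall_norm_le`); mixed norms of smooth fields are finite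
  (`IsSmoothSpaceTimeOn.eLqLpNorm_lt_top`);
* **Minkowski** in `L^q_t L^p_x`, `q, p ≥ 1` (`Torus.eLqLpNorm_add_le_of_smooth`);
* **monotonicity in the space exponent** on the probability space `𝕋^d`
  (`Torus.eLqLpNorm_mono_exponent_of_smooth`);
* a smooth field with vanishing mixed norm **vanishes identically** on `[0, T] × 𝕋^d`
  (`Torus.eq_zero_of_eLqLpNorm_eq_zero`).

First consumer: the assembly of Cheskidov–Luo 2022, Prop. 2.2 from Props. 3.1 and 4.1
(`Literature.Analysis.FluidPDE.NavierStokesReynoldsSteps`).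

## References

* J. Serrin, *The initial value problem for the Navier–Stokes equations* (1963), §3 (mixed norms).
* J. C. Robinson, J. L. Rodrigo, W. Sadowski, *The Three-Dimensional Navier–Stokes Equations*,
  CUP 2016, §1.7 (Bochner spaces `L^p(0,T;X)`).
-/

open MeasureTheory Set Topology Filter
open scoped ENNReal NNReal ContDiff

noncomputable section

namespace Literature.Analysis.FluidPDE

namespace Torus

variable {d : Type*} [Fintype d]

/-! ## Mixed norms of jointly smooth space–time fields -/

section MixedSmooth

variable {F : Type*} [NormedAddCommGroup F] [NormedSpace ℝ F]

variable {S : Set ℝ} {T : ℝ} {w w₁ w₂ : ℝ → UnitAddTorus d → F}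

/-- Time slices of a jointly smooth field have finite `L^p` norms (smooth on the compact torus).
[folklore] -/
theorem _root_.Literature.Analysis.FunctionSpaces.Torus.IsSmoothSpaceTimeOn.eLpNorm_slice_lt_top
    (hw : FunctionSpaces.Torus.IsSmoothSpaceTimeOn S w) {t : ℝ} (ht : t ∈ S) (p : ℝ≥0∞) :
    eLpNorm (w t) p volume < ⊤ :=
  ((hw.isSmooth_slice ht).memLp p).eLpNorm_lt_top

/-- **Continuity in time of the slice norms.** For a jointly smooth field `w` on `S × 𝕋^d` and
`1 ≤ p ≤ ∞`, `t ↦ ‖w(t)‖_{L^p(𝕋^d)}` is continuous on `S`: by the tube lemma over the compact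
torus `sup_x ‖w(s,x) - w(t,x)‖ → 0` as `s → t` within `S`, and
`|‖w(s)‖_{L^p} - ‖w(t)‖_{L^p}| ≤ ‖w(s) - w(t)‖_{L^p} ≤ sup_x ‖w(s,x) - w(t,x)‖`. [folklore] -/
theorem _root_.Literature.Analysis.FunctionSpaces.Torus.IsSmoothSpaceTimeOn.continuousOn_eLpNorm_toReal
    (hw : FunctionSpaces.Torus.IsSmoothSpaceTimeOn S w) {p : ℝ≥0∞} (hp : 1 ≤ p) :
    ContinuousOn (fun t => (eLpNorm (w t) p volume).toReal) S := by
  intro t ht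
  rw [ContinuousWithinAt, Metric.tendsto_nhds]
  intro ε hε
  have hev := hw.eventually_norm_sub_lt ht (half_pos hε)
  filter_upwards [hev, self_mem_nhdsWithin] with s hs hsS
  have hms : AEStronglyMeasurable (w s) volume :=
    (hw.isSmooth_slice hsS).continuous.aestronglyMeasurable
  have hmt : AEStronglyMeasurable (w t) volume :=
    (hw.isSmooth_slice ht).continuous.aestronglyMeasurable
  have hfs : eLpNorm (w s) p volume < ⊤ := hw.eLpNorm_slice_lt_top hsS p
  have hft : eLpNorm (w t) p volume < ⊤ := hw.eLpNorm_slice_lt_top ht p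
  have hd1 : eLpNorm (w s - w t) p volume ≤ ENNReal.ofReal (ε / 2) :=
    eLpNorm_le_of_forall_norm_le (fun x => (hs x).le) p
  have hd2 : eLpNorm (w t - w s) p volume ≤ ENNReal.ofReal (ε / 2) := by
    rw [← eLpNorm_neg, neg_sub]; exact hd1
  have h1 : eLpNorm (w s) p volume ≤ eLpNorm (w t) p volume + ENNReal.ofReal (ε / 2) := by
    calc eLpNorm (w s) p volume = eLpNorm (w t + (w s - w t)) p volume := by rw [add_sub_cancel]
      _ ≤ eLpNorm (w t) p volume + eLpNorm (w s - w t) p volume :=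
          eLpNorm_add_le hmt (hms.sub hmt) hp
      _ ≤ _ := by gcongr
  have h2 : eLpNorm (w t) p volume ≤ eLpNorm (w s) p volume + ENNReal.ofReal (ε / 2) := by
    calc eLpNorm (w t) p volume = eLpNorm (w s + (w t - w s)) p volume := by rw [add_sub_cancel]
      _ ≤ eLpNorm (w s) p volume + eLpNorm (w t - w s) p volume :=
          eLpNorm_add_le hms (hmt.sub hms) hp
      _ ≤ _ := by gcongr
  have hε2 : 0 ≤ ε / 2 := (half_pos hε).le
  have h1' : (eLpNorm (w s) p volume).toReal ≤ (eLpNorm (w t) p volume).toReal + ε / 2 := by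
    have := ENNReal.toReal_mono (ENNReal.add_ne_top.2 ⟨hft.ne, ENNReal.ofReal_ne_top⟩) h1
    rwa [ENNReal.toReal_add hft.ne ENNReal.ofReal_ne_top, ENNReal.toReal_ofReal hε2] at this
  have h2' : (eLpNorm (w t) p volume).toReal ≤ (eLpNorm (w s) p volume).toReal + ε / 2 := by
    have := ENNReal.toReal_mono (ENNReal.add_ne_top.2 ⟨hfs.ne, ENNReal.ofReal_ne_top⟩) h2
    rwa [ENNReal.toReal_add hfs.ne ENNReal.ofReal_ne_top, ENNReal.toReal_ofReal hε2] at this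
  rw [Real.dist_eq, abs_lt]
  constructor <;> linarith

/-- Slice norms of a jointly smooth field on `[0, T] × 𝕋^d` are a.e. strongly measurable in time
on `(0, T)` (they are continuous). [folklore] -/
theorem _root_.Literature.Analysis.FunctionSpaces.Torus.IsSmoothSpaceTimeOn.aestronglyMeasurable_eLpNorm_toReal
    (hw : FunctionSpaces.Torus.IsSmoothSpaceTimeOn (Icc 0 T) w) {p : ℝ≥0∞} (hp : 1 ≤ p) :
    AEStronglyMeasurable (fun t => (eLpNorm (w t) p volume).toReal) (volume.restrict (Ioo 0 T)) :=
  ((hw.continuousOn_eLpNorm_toReal hp).mono Ioo_subset_Icc_self).aestronglyMeasurable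
    measurableSet_Ioo

omit [NormedSpace ℝ F] in
/-- **Mixed norms of uniformly small fields are small.** If `‖w(t, x)‖ ≤ C` for all `t ∈ (0, T)`
and all `x ∈ 𝕋^d`, then `‖w‖_{L^q(0,T;L^p)} ≤ max(1, T) · C` for every `q ≥ 1` and every `p`
(the torus has measure `1`, `(0, T)` has measure `T`, and `T^{1/q} ≤ max(1, T)`). [folklore] -/
theorem eLqLpNorm_le_of_forall_norm_le {C : ℝ} (hC : 0 ≤ C) {q : ℝ≥0∞} (hq : 1 ≤ q)
    (p : ℝ≥0∞) (h : ∀ t ∈ Ioo 0 T, ∀ x, ‖w t x‖ ≤ C) :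
    eLqLpNorm q p w (Ioo 0 T) ≤ ENNReal.ofReal (max 1 T * C) := by
  rw [eLqLpNorm, FluidPDE.eLqLpNorm]
  have hb : ∀ᵐ t ∂(volume.restrict (Ioo 0 T)), ‖(eLpNorm (w t) p volume).toReal‖ ≤ C := by
    refine ae_restrict_of_forall_mem measurableSet_Ioo fun t ht => ?_
    rw [Real.norm_of_nonneg ENNReal.toReal_nonneg]
    exact ENNReal.toReal_le_of_le_ofReal hC (eLpNorm_le_of_forall_norm_le (h t ht) p)
  refine (eLpNorm_le_of_ae_bound hb).trans ?_
  rw [Measure.restrict_apply_univ, Real.volume_Ioo, sub_zero,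
    ENNReal.ofReal_mul (le_max_of_le_left zero_le_one)]
  gcongr
  -- `(ofReal T) ^ q.toReal⁻¹ ≤ ofReal (max 1 T)`
  have hexp0 : 0 ≤ q.toReal⁻¹ := inv_nonneg.2 ENNReal.toReal_nonneg
  have hexp1 : q.toReal⁻¹ ≤ 1 := by
    rcases eq_or_ne q ⊤ with rfl | hq'
    · simp
    · have h1 : 1 ≤ q.toReal := by
        rw [← ENNReal.toReal_one]; exact (ENNReal.toReal_le_toReal ENNReal.one_ne_top hq').2 hq
      exact inv_le_one_of_one_le₀ h1
  rcases le_total T 1 with hT1 | hT1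
  · rw [max_eq_left hT1, ENNReal.ofReal_one]
    exact ENNReal.rpow_le_one (ENNReal.ofReal_le_one.2 hT1) hexp0
  · rw [max_eq_right hT1]
    calc ENNReal.ofReal T ^ q.toReal⁻¹ ≤ ENNReal.ofReal T ^ (1 : ℝ) :=
          ENNReal.rpow_le_rpow_of_exponent_le (ENNReal.one_le_ofReal.2 hT1) hexp1
      _ = ENNReal.ofReal T := ENNReal.rpow_one _

/-- Mixed norms `L^q(0,T; L^p)`, `q ≥ 1`, of jointly smooth fields on `[0, T] × 𝕋^d` are finite
(the field is bounded on the compact `[0, T] × 𝕋^d`). [folklore] -/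
theorem _root_.Literature.Analysis.FunctionSpaces.Torus.IsSmoothSpaceTimeOn.eLqLpNorm_lt_top
    (hw : FunctionSpaces.Torus.IsSmoothSpaceTimeOn (Icc 0 T) w) {q : ℝ≥0∞} (hq : 1 ≤ q)
    (p : ℝ≥0∞) : eLqLpNorm q p w (Ioo 0 T) < ⊤ := by
  obtain ⟨C, hC⟩ := hw.exists_norm_le_of_isCompact isCompact_Icc subset_rfl
  have hC0 : 0 ≤ max C 0 := le_max_right _ _
  exact (eLqLpNorm_le_of_forall_norm_le hC0 hq p fun t ht x =>
    (hC t (Ioo_subset_Icc_self ht) x).trans (le_max_left _ _)).trans_lt ENNReal.ofReal_lt_top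

/-- **Minkowski's inequality for the mixed norms** `L^q(0,T; L^p(𝕋^d))`, `q, p ≥ 1`, of jointly
smooth fields on `[0, T] × 𝕋^d` (Minkowski in `x` slice-wise, then in `t`; the slice norms are
finite and continuous in time, so no junk value intervenes). [folklore] -/
theorem eLqLpNorm_add_le_of_smooth (hw₁ : FunctionSpaces.Torus.IsSmoothSpaceTimeOn (Icc 0 T) w₁)
    (hw₂ : FunctionSpaces.Torus.IsSmoothSpaceTimeOn (Icc 0 T) w₂) {q p : ℝ≥0∞} (hq : 1 ≤ q)
    (hp : 1 ≤ p) :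
    eLqLpNorm q p (fun t x => w₁ t x + w₂ t x) (Ioo 0 T) ≤
      eLqLpNorm q p w₁ (Ioo 0 T) + eLqLpNorm q p w₂ (Ioo 0 T) := by
  simp only [eLqLpNorm, FluidPDE.eLqLpNorm]
  have hpt : ∀ t ∈ Ioo 0 T, (eLpNorm (fun x => w₁ t x + w₂ t x) p volume).toReal ≤
      (eLpNorm (w₁ t) p volume).toReal + (eLpNorm (w₂ t) p volume).toReal := by
    intro t ht
    have ht' : t ∈ Icc 0 T := Ioo_subset_Icc_self ht
    have h1 : eLpNorm (fun x => w₁ t x + w₂ t x) p volume ≤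
        eLpNorm (w₁ t) p volume + eLpNorm (w₂ t) p volume :=
      eLpNorm_add_le (hw₁.isSmooth_slice ht').continuous.aestronglyMeasurable
        (hw₂.isSmooth_slice ht').continuous.aestronglyMeasurable hp
    have hf1 := (hw₁.eLpNorm_slice_lt_top ht' p).ne
    have hf2 := (hw₂.eLpNorm_slice_lt_top ht' p).ne
    rw [← ENNReal.toReal_add hf1 hf2]
    exact ENNReal.toReal_mono (ENNReal.add_ne_top.2 ⟨hf1, hf2⟩) h1
  calc eLpNorm (fun t => (eLpNorm (fun x => w₁ t x + w₂ t x) p volume).toReal) q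
        (volume.restrict (Ioo 0 T))
      ≤ eLpNorm ((fun t => (eLpNorm (w₁ t) p volume).toReal) + fun t => (eLpNorm (w₂ t) p volume).toReal)
          q (volume.restrict (Ioo 0 T)) := by
        refine eLpNorm_mono_ae (ae_restrict_of_forall_mem measurableSet_Ioo fun t ht => ?_)
        rw [Real.norm_of_nonneg ENNReal.toReal_nonneg, Pi.add_apply,
          Real.norm_of_nonneg (add_nonneg ENNReal.toReal_nonneg ENNReal.toReal_nonneg)]
        exact hpt t ht
    _ ≤ _ := eLpNorm_add_le (hw₁.aestronglyMeasurable_eLpNorm_toReal hp)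
          (hw₂.aestronglyMeasurable_eLpNorm_toReal hp) hq

/-- **Monotonicity of the mixed norms in the space exponent** on the torus (a probability space):
`‖w‖_{L^q(0,T;L^p)} ≤ ‖w‖_{L^q(0,T;L^{p'})}` for `p ≤ p'` and jointly smooth `w`. [folklore] -/
theorem eLqLpNorm_mono_exponent_of_smooth (hw : FunctionSpaces.Torus.IsSmoothSpaceTimeOn (Icc 0 T) w)
    (q : ℝ≥0∞) {p p' : ℝ≥0∞} (hpp' : p ≤ p') :
    eLqLpNorm q p w (Ioo 0 T) ≤ eLqLpNorm q p' w (Ioo 0 T) := by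
  simp only [eLqLpNorm, FluidPDE.eLqLpNorm]
  refine eLpNorm_mono_ae (ae_restrict_of_forall_mem measurableSet_Ioo fun t ht => ?_)
  have ht' : t ∈ Icc 0 T := Ioo_subset_Icc_self ht
  rw [Real.norm_of_nonneg ENNReal.toReal_nonneg, Real.norm_of_nonneg ENNReal.toReal_nonneg]
  exact ENNReal.toReal_mono (hw.eLpNorm_slice_lt_top ht' p').ne
    (eLpNorm_le_eLpNorm_of_exponent_le hpp' (hw.isSmooth_slice ht').continuous.aestronglyMeasurable)

/-- **A jointly smooth field with vanishing mixed norm vanishes identically on `[0, T] × 𝕋^d`**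
(`T > 0`, `q ≠ 0`, `p ≥ 1`): the slice norms are continuous in time and vanish a.e. on `(0, T)`,
hence everywhere on `[0, T]`; a continuous slice with zero `L^p` norm vanishes everywhere since
Haar measure charges open sets. [folklore] -/
theorem eq_zero_of_eLqLpNorm_eq_zero (hw : FunctionSpaces.Torus.IsSmoothSpaceTimeOn (Icc 0 T) w)
    (hT : 0 < T) {q p : ℝ≥0∞} (hq : q ≠ 0) (hp : 1 ≤ p) (h0 : eLqLpNorm q p w (Ioo 0 T) = 0) :
    ∀ t ∈ Icc 0 T, ∀ x, w t x = 0 := by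
  simp only [eLqLpNorm, FluidPDE.eLqLpNorm] at h0
  rw [eLpNorm_eq_zero_iff (hw.aestronglyMeasurable_eLpNorm_toReal hp) hq,
    Measure.restrict_congr_set Ioo_ae_eq_Icc] at h0
  have hI : EqOn (fun t => (eLpNorm (w t) p volume).toReal) 0 (Icc 0 T) :=
    Measure.eqOn_Icc_of_ae_eq volume hT.ne h0 (hw.continuousOn_eLpNorm_toReal hp) continuousOn_const
  intro t ht
  have h1 : eLpNorm (w t) p volume = 0 := by
    have h2 := hI ht
    simp only [Pi.zero_apply] at h2
    exact (ENNReal.toReal_eq_zero_iff _ |>.1 h2).resolve_right (hw.eLpNorm_slice_lt_top ht p).ne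
  have hp0 : p ≠ 0 := (lt_of_lt_of_le zero_lt_one hp).ne'
  rw [eLpNorm_eq_zero_iff (hw.isSmooth_slice ht).continuous.aestronglyMeasurable hp0] at h1
  have h3 : w t = 0 := Measure.eq_of_ae_eq h1 (hw.isSmooth_slice ht).continuous continuous_const
  exact fun x => congrFun h3 x

end MixedSmooth

end Torus

end Literature.Analysis.FluidPDE
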